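import Literature.NumberTheory.EllipticCurves.CanonicalPAdicHeightJunkSigmaProofs
import Literature.NumberTheory.EllipticCurves.PadicSigmaUniquenessProofs
import Literature.NumberTheory.EllipticCurves.CyclotomicPAdicHeight
import HarnessLib

/-!
# At `p = 2` the tree's canonicity predicate for `p`-adic heights is UNSATISFIABLE on every curve with
# `a₁` odd and a point of infinite order (the Mazur–Tate `σ` is not `2`-integral; proofs only)

Topic `Literature/NumberTheory/EllipticCurves` (trunk T-NT-EC); sibling proof file of
`CanonicalPAdicHeight.lean`, `PadicSigma.lean`, `CanonicalPAdicHeightJunkSigmaProofs.lean`. Pure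
proofs: NO definition, NO named fact, nothing asserted about mathematics beyond the tree's own
conventions (net literature debt `0`). Typer seat `bsd-goldfeld-ty` g8 of the cell `bsd-goldfeld`
(HOME `run/shared/lean/pub/bsd-goldfeld/`, memo `TY-HYPOTHESES-AT-TWO.md` §10), in support of the
route item stmt-BirchSwinnertonDyer-19141 (Li–Tian–Yan–Zhu 2025 Thm. 1.1, the `2`-part of BSD for CM
curves of analytic rank one with good ordinary reduction at `2`): this file is the KERNEL FORM of the
obstruction «the tree has no currency for THE canonical `2`-adic height» recorded in prose by the
earlier generations of the seat (memo §9.2 (i)). It decides which road a `p = 2` height fact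
(Bertrand 1984 at `2`, Disegni 2017 Thm. B at `2`, LTYZ 2025 Thm. 6.1 / 7.6 / 8.2) may NOT take.

## What the tree pins, and why it pins nothing at `p = 2`

The tree PINS the canonical cyclotomic `p`-adic height through the Mazur–Tate sigma formula
`ĥ_p(P) = log_p den x(P) − 2 log_p σ_p(z(P))` (`WeierstrassCurve.canonicalPAdicHeight`,
`PAdicHeightData.IsCanonical`; Stein–Wuthrich 2013 §4.1 (4.1) = `−2p ×` Mazur–Stein–Tate 2006 (1.1)),
where `σ_p = padicSigma (W ⊗ ℚ_p)` is THE pair `(σ, c)` with `σ = t + ⋯ ∈ tℤ_p⟦t⟧` odd, `c ∈ ℤ_p` and the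
sigma ODE (`IsMazurTateSigmaPair`; MST 2006 Thm. 1.3 «There is exactly one odd function
`σ(t) = t + ⋯ ∈ tℤ_p⟦t⟧` …», stated there for «`p` an odd prime number», §1 p. 2), and the JUNK
series `σ = t` when no such pair exists (`mazurTatePair`). Oddness forces `2·[t²]σ = a₁`
(`IsMazurTateSigmaPair.two_mul_coeff_two`), so a pair can only exist when `‖a₁‖_p ≤ ‖2‖_p`
(`IsMazurTateSigmaPair.norm_a₁_le_norm_two`, any `p`). At `p = 2` this EXCLUDES every equation with
`a₁` odd — in particular every `2`-minimal model with good ORDINARY reduction at `2` (in characteristic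
`2` the curve `y² + a₁xy + a₃y = x³ + ⋯` is supersingular iff `a₁ = 0`: Silverman AEC A.1.1(c) and
Ex. A.1(b) / V.4 — a remark, not used below; the hypothesis carried here is `‖a₁‖₂ = 1` itself), e.g.
`X₀(49) = [1, −1, 0, −2, −1]` and its prime-to-`2` quadratic twists, the curves of LTYZ 2025 §3 «Let
`A = X₀(49)`, and let `E = A^{(D)}` … `D ≡ 1 (mod 4)`» (authors' version p. 5). This is not an artefact
of the tree: it is the printed situation — Silverman, Math. Ann. 332 (2005) 443–471 = arXiv
math/0404412, §5 Thm. 11 (Mazur–Tate 1991 Thm. 3.1, «assume that `p ≥ 3` and that `𝓔` has good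
ordinary reduction. Then there is a unique power series `σ ∈ z + z²R⟦z⟧` …») and Remark 2: «Theorem 11
remains true for `p = 2` provided that everything is squared. That is, there is a unique power series
`σ² ∈ z² + z³R⟦z⟧` satisfying `σ²(nQ) = σ(Q)^{2n²}F_n²(Q)`. But it is not possible to unambiguously take
a square root …» (held text `paper:arxiv-math-0404412`, chunk p0011); Stein–Wuthrich 2013 p. 4 «we
exclude `p = 2` … Iwasawa theory is not as well developed for `p = 2`»; MST 2006 §1 «Let `p` be an odd
prime number».

Consequently at `p = 2`, on such a curve, `σ₂` is the junk `t` (`padicSigma_two_eq_X_of_norm_a₁_eq_one`),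
the «canonical height» of the tree is the junk function `log₂ den x − 2 log₂(−x/y)`
(`canonicalPAdicHeight_two_some_of_norm_a₁_eq_one`), and — the point of this file — that junk function
is NOT the quadratic form of any bilinear symmetric torsion-vanishing pairing: it separates `Q` from
`−Q` on admissible points (`canonicalPAdicHeight_neg_ne_of_not_exists_of_norm_div_lt`, the `p`-uniform
form of the tree's odd-`p` lemma `canonicalPAdicHeight_neg_ne_of_not_exists`; at `p = 2` the isometry
radius `‖w‖ < ‖2‖₂ = ½` of `log₂` is supplied by the admissibility clause `InSigmaDisc 2 (z(Q))`, i.e.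
`‖z(Q)‖₂ < ½`). Hence:

* `PAdicHeightData.IsCanonical.exists_isMazurTateSigmaPair_two` — at `p = 2` too, a canonical datum
  plus ONE admissible point `Q` with `a₁x(Q) + a₃ ≠ 0` forces a genuine Mazur–Tate pair (the `p = 2`
  twin of the tree's odd-`p` theorem);
* **`PAdicHeightData.not_isCanonical_two_of_isAdmissible`**, **`…_of_not_isOfFinAddOrder`**,
  **`not_exists_isCanonical_two_of_mordellWeilRank_ne_zero`** — for a `ℤ`-integral elliptic `W/ℚ`
  with `‖a₁‖₂ = 1` and an admissible point / a point of infinite order / `rank E(ℚ) ≠ 0`: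
  **no `Dh : PAdicHeightData W 2` is canonical**;
* `cyclotomicPAdicHeight_two_eq_zero_of_mordellWeilRank_ne_zero` — the tree's chosen «canonical
  `2`-adic height datum» `cyclotomicPAdicHeight W 2` of such a curve is the ZERO pairing (junk branch
  of `CyclotomicPAdicHeight.lean`), and `padicRegulator_cyclotomicPAdicHeight_two_eq_zero`: its
  regulator is `0`.

READING (for typers; nothing here is a claim about the canonical height of Schneider / Mazur–Tate /
Perrin-Riou, which EXISTS at `p = 2` for ordinary reduction — Mazur–Tate 1983, Schneider 1982 — and is
the pairing LTYZ 2025 §2.2 p. 4 call «the `p`-adic height pairing associated with the cyclotomic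
character over `K`»): every tree fact of the shape `∀ Dh : PAdicHeightData W 2, Dh.IsCanonical → …` is
VACUOUSLY TRUE on the curves of LTYZ Thm. 1.1 (ii) at `p = 2` (rank one, good ordinary at `2`), and the
`p = 2` analogue of `exists_isCanonical` / `exists_isCanonical_of_odd` is FALSE there; so neither form
can carry Bertrand's non-vanishing, Disegni's `2`-adic Gross–Zagier formula or LTYZ's (6.1)/(7.7) at
`p = 2`. The honest receptacle (successor work, memo §10) is the SQUARED sigma function of Mazur–Tate
1991 / Silverman 2005 Rem. 2 (`Σ = σ² ∈ t² + t³ℤ₂⟦t⟧`, `ĥ₂ = log₂ den x − log₂ Σ(z)` — the tree's formula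
already only involves `σ²`), for which the present obstruction disappears (`[t³]Σ = a₁ ∈ ℤ₂`).

## References

* [MazurSteinTate2006] B. Mazur, W. Stein, J. Tate, *Computation of `p`-adic heights and log
  convergence*, Doc. Math. Extra Vol. Coates (2006), §1 (p. 2 «`p` an odd prime»), eq. (1.1), Thm. 1.3,
  Rem. 1.4.
* [SteinWuthrich2013] W. Stein, C. Wuthrich, Math. Comp. 82 (2013), §1 p. 4 («we exclude `p = 2`»),
  §4.1 eq. (4.1).
* [Silverman2005DivPoly] J. H. Silverman, *`p`-adic properties of division polynomials and elliptic
  divisibility sequences*, Math. Ann. 332 (2005) 443–471 (arXiv math/0404412), §5 Thm. 11 and Remark 2.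
* [MazurTate1991] B. Mazur, J. Tate, *The `p`-adic sigma function*, Duke Math. J. 62 (1991), Thm. 3.1
  (not held; cited through Silverman 2005 and MST 2006).
* [LiTianYanZhu2025] Y. Li, Y. Tian, X. Yan, X. Zhu, Pure Appl. Math. Q. 21 (2025), §2.2 p. 4, §3 p. 5.
* [Iwasawa1972PadicL] K. Iwasawa, *Lectures on `p`-adic `L`-functions* (1972), §4.4 (`log_p`).
* [SilvermanAEC2009] J. H. Silverman, *AEC* 2nd ed., VII.2.1–2.2, A.1.1.

## Design

Pure proof file over the tree's definitions; hypotheses `[W.IsIntegral ℤ]` (+ `[W.IsElliptic]` where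
the admissible locus is used) and `‖(a₁ : ℚ₂)‖ = 1`; no minimality, no reduction type, no named fact
consumed except the tree THEOREMS `padicLog_mul_holds` (inside the imported odd-`p` lemmas) and
`IsMordellWeilBasis.card_eq_holds`. Standard axioms.
-/

noncomputable section

open scoped Classical
open PowerSeries Literature.NumberTheory.EllipticCurves

namespace WeierstrassCurve

/-! ### A Mazur–Tate pair forces `‖a₁‖_p ≤ ‖2‖_p` (any prime) -/

section AnyPrime

variable {p : ℕ} [Fact p.Prime] {V : WeierstrassCurve ℚ_[p]}

/-- **`‖a₁‖_p ≤ ‖2‖_p` for an equation carrying a Mazur–Tate pair**: `σ = t + c₂t² + ⋯` odd forces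
`2c₂ = a₁` (`two_mul_coeff_two`) and `c₂ ∈ ℤ_p`. Vacuous restriction at odd `p`; at `p = 2` it says
`2 ∣ a₁`. [Mazur–Stein–Tate 2006, Thm. 1.3 and Rem. 1.4; Silverman 2005, §5 Rem. 2]
[cite: MazurSteinTate2006, Thm. 1.3] [cite: Silverman2005DivPoly, §5 Thm. 11 and Rem. 2] -/
theorem IsMazurTateSigmaPair.norm_a₁_le_norm_two {σ : ℚ_[p]⟦X⟧} {c : ℚ_[p]}
    (h : V.IsMazurTateSigmaPair σ c) : ‖V.a₁‖ ≤ ‖(2 : ℚ_[p])‖ := by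
  rw [← h.two_mul_coeff_two, norm_mul]
  exact mul_le_of_le_one_right (norm_nonneg _) (h.norm_coeff_le 2)

/-- No Mazur–Tate pair exists when `‖a₁‖_p > ‖2‖_p` (only possible at `p = 2`: `a₁` a `2`-adic unit).
[cite: MazurSteinTate2006, Thm. 1.3] [cite: Silverman2005DivPoly, §5 Rem. 2] -/
theorem not_exists_isMazurTateSigmaPair_of_norm_two_lt (hV : ‖(2 : ℚ_[p])‖ < ‖V.a₁‖) :
    ¬ ∃ σ : ℚ_[p]⟦X⟧, ∃ c : ℚ_[p], V.IsMazurTateSigmaPair σ c := by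
  rintro ⟨σ, c, h⟩
  exact h.norm_a₁_le_norm_two.not_gt hV

end AnyPrime

/-! ### The junk branch at `p = 2` for `a₁` odd -/

section Two

variable (W : WeierstrassCurve ℚ)

/-- `‖2‖₂ = ½`. [folklore] -/
private theorem norm_two_padic_two : ‖(2 : ℚ_[2])‖ = 2⁻¹ := by
  have h := Padic.norm_p (p := 2)
  simp only [Nat.cast_ofNat] at h
  exact h

/-- **At `p = 2`, an equation over `ℚ` with `a₁` a `2`-adic unit carries NO Mazur–Tate pair**
(`‖a₁‖₂ = 1 > ½ = ‖2‖₂`). This is the case of every `2`-minimal model with good ordinary reduction at `2`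
(supersingular in characteristic `2` iff `a₁ = 0`), e.g. `X₀(49) = [1,−1,0,−2,−1]` and its prime-to-`2`
quadratic twists. [Silverman 2005, §5 Thm. 11 («`p ≥ 3`») and Rem. 2 («for `p = 2` … everything is
squared … not possible to unambiguously take a square root»)] [cite: Silverman2005DivPoly, §5 Rem. 2]
[cite: MazurSteinTate2006, Thm. 1.3] -/
theorem not_exists_isMazurTateSigmaPair_two_of_norm_a₁_eq_one (ha₁ : ‖((W.a₁ : ℚ) : ℚ_[2])‖ = 1) :
    ¬ ∃ σ : ℚ_[2]⟦X⟧, ∃ c : ℚ_[2], (W.baseChange ℚ_[2]).IsMazurTateSigmaPair σ c := by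
  apply not_exists_isMazurTateSigmaPair_of_norm_two_lt
  have ha : (W.baseChange ℚ_[2]).a₁ = ((W.a₁ : ℚ) : ℚ_[2]) := by
    simp [WeierstrassCurve.baseChange, WeierstrassCurve.map_a₁]
  rw [ha, ha₁, norm_two_padic_two]
  norm_num

/-- Junk branch at `2`: `σ₂ = t` (the tree's convention `mazurTatePair = (t, 0)` when no pair exists).
[cite: MazurSteinTate2006, Thm. 1.3] -/
theorem padicSigma_two_eq_X_of_norm_a₁_eq_one (ha₁ : ‖((W.a₁ : ℚ) : ℚ_[2])‖ = 1) :
    (W.baseChange ℚ_[2]).padicSigma = X :=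
  (W.baseChange ℚ_[2]).padicSigma_eq_X_of_not_exists
    (W.not_exists_isMazurTateSigmaPair_two_of_norm_a₁_eq_one ha₁)

/-- Junk branch at `2`: `σ₂(t) = t` for every `t ∈ ℚ₂`. [cite: MazurSteinTate2006, Thm. 1.3] -/
theorem padicSigmaEval_two_eq_self_of_norm_a₁_eq_one (ha₁ : ‖((W.a₁ : ℚ) : ℚ_[2])‖ = 1)
    (t : ℚ_[2]) : W.padicSigmaEval 2 t = t :=
  W.padicSigmaEval_eq_self_of_not_exists 2 (W.not_exists_isMazurTateSigmaPair_two_of_norm_a₁_eq_one ha₁) t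

variable {W} in
/-- Junk branch at `2`: the tree's «canonical `2`-adic height» of `(x, y)` is the junk function
`log₂ den x − 2 log₂(−x/y)` — no sigma function, no `E₂`, in it.
[cite: SteinWuthrich2013, §4.1 eq. (4.1)] [cite: MazurSteinTate2006, §1 eq. (1.1)] -/
theorem canonicalPAdicHeight_two_some_of_norm_a₁_eq_one (ha₁ : ‖((W.a₁ : ℚ) : ℚ_[2])‖ = 1)
    {x y : ℚ} (hxy : W.toAffine.Nonsingular x y) :
    W.canonicalPAdicHeight 2 (.some x y hxy) =
      padicLog 2 ((x.den : ℚ) : ℚ_[2]) - 2 * padicLog 2 (-(x : ℚ_[2]) / y) :=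
  canonicalPAdicHeight_some_of_not_exists (W.not_exists_isMazurTateSigmaPair_two_of_norm_a₁_eq_one ha₁) hxy

end Two

/-! ### In the junk branch `ĥ_p(−Q) ≠ ĥ_p(Q)` — uniform in `p`, the radius supplied by the sigma disc -/

section NegNe

variable (W : WeierstrassCurve ℚ) (p : ℕ) [Fact p.Prime]

variable {W p} in
/-- **In the junk branch `ĥ_p(−Q) ≠ ĥ_p(Q)`**, uniformly in `p`: for `Q = (x, y)` on a `ℤ`-integral
equation with `‖x‖_p > 1`, `‖x/y‖_p < ‖2‖_p` and `a₁x + a₃ ≠ 0`, the junk heights of `Q` and `−Q` differ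
by `2 log_p(1 + w)`, `w = (a₁x + a₃)/y`, `0 < ‖w‖_p ≤ ‖x/y‖_p < ‖2‖_p`, and `log_p` is an isometry there
(`norm_padicLogSeries_eq`). The tree's `canonicalPAdicHeight_neg_ne_of_not_exists` is the case `p` odd
(`‖2‖_p = 1`, so `‖x/y‖_p < 1` suffices); at `p = 2` the extra room is exactly the sigma-disc clause of
admissibility. [cite: Iwasawa1972PadicL, §4.4] [cite: SteinWuthrich2013, §4.1 eq. (4.1)] -/
theorem canonicalPAdicHeight_neg_ne_of_not_exists_of_norm_div_lt [W.IsIntegral ℤ]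
    (h : ¬ ∃ σ : ℚ_[p]⟦X⟧, ∃ c : ℚ_[p], (W.baseChange ℚ_[p]).IsMazurTateSigmaPair σ c)
    {x y : ℚ} (hxy : W.toAffine.Nonsingular x y) (hx : 1 < ‖(x : ℚ_[p])‖)
    (hz : ‖(x : ℚ_[p]) / y‖ < ‖(2 : ℚ_[p])‖) (ha : W.a₁ * x + W.a₃ ≠ 0) :
    W.canonicalPAdicHeight p (-(.some x y hxy)) ≠ W.canonicalPAdicHeight p (.some x y hxy) := by
  intro heq
  obtain ⟨hy0, hwle, -, -⟩ := W.norm_a₁x_add_a₃_div_y_lt_one (p := p) hxy hx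
  have hsub := W.canonicalPAdicHeight_neg_sub_eq_of_not_exists (p := p) h hxy hx
  rw [heq, sub_self] at hsub
  have hlog : padicLog p (1 + ((W.a₁ * x + W.a₃ : ℚ) : ℚ_[p]) / y) = 0 :=
    (mul_eq_zero.mp hsub.symm).resolve_left two_ne_zero
  set w : ℚ_[p] := ((W.a₁ * x + W.a₃ : ℚ) : ℚ_[p]) / y with hwdef
  have h2le : ‖(2 : ℚ_[p])‖ ≤ 1 := by
    have := Padic.norm_int_le_one (p := p) 2
    exact_mod_cast this
  have hw2 : ‖w‖ < ‖(2 : ℚ_[p])‖ := hwle.trans_lt hz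
  have hw1 : ‖w‖ < 1 := hw2.trans_le h2le
  have hw1' : ‖1 - (1 + w)‖ < 1 := by rwa [sub_add_cancel_left, norm_neg]
  have hw2' : ‖1 - (1 + w)‖ < ‖(2 : ℚ_[p])‖ := by rwa [sub_add_cancel_left, norm_neg]
  rw [padicLog_eq_padicLogSeries hw1'] at hlog
  have hnorm := norm_padicLogSeries_eq hw2'
  rw [hlog, norm_zero, sub_add_cancel_left, norm_neg] at hnorm
  have hw0 : w = 0 := norm_eq_zero.mp hnorm.symm
  rw [hwdef, div_eq_zero_iff] at hw0
  rcases hw0 with hw0 | hw0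
  · exact ha (by exact_mod_cast hw0)
  · exact hy0 hw0

variable {W} in
/-- The sigma-disc clause of admissibility at `p = 2` in the form used above: `‖x/y‖₂ < ‖2‖₂` for an
admissible `Q = (x, y)` (`InSigmaDisc 2 (−x/y)`: `‖z‖ < 2^{−1/(2−1)} = ½`).
[cite: SteinWuthrich2013, §4 (range of convergence of σ)] -/
theorem norm_div_lt_norm_two_of_isAdmissible_two {x y : ℚ} {hxy : W.toAffine.Nonsingular x y}
    (hQ : W.IsAdmissible 2 (.some x y hxy)) : ‖(x : ℚ_[2]) / y‖ < ‖(2 : ℚ_[2])‖ := by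
  have hdisc : InSigmaDisc 2 (-(x : ℚ_[2]) / y) := hQ.2.2.1
  unfold InSigmaDisc at hdisc
  rw [neg_div, norm_neg] at hdisc
  have hrad : ((2 : ℕ) : ℝ) ^ (-(1 / (((2 : ℕ) : ℝ) - 1))) = 2⁻¹ := by
    rw [show (-(1 / (((2 : ℕ) : ℝ) - 1))) = (-1 : ℝ) by norm_num, Nat.cast_ofNat, Real.rpow_neg_one]
  rw [hrad] at hdisc
  rwa [norm_two_padic_two]

end NegNe

/-! ### No canonical datum at `p = 2` when `a₁` is odd -/

section NoCanonical

variable (W : WeierstrassCurve ℚ)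

variable {W} in
/-- **At `p = 2` as well, a canonical datum forces the Mazur–Tate pair**: for a `ℤ`-integral elliptic
`W/ℚ`, `Dh : PAdicHeightData W 2` with `Dh.IsCanonical`, and ONE admissible `Q = (x, y)` with
`a₁x + a₃ ≠ 0`, the curve `W ⊗ ℚ₂` has a Mazur–Tate pair — else `σ₂ = t`, `−Q` is admissible too, and
`⟨Q,Q⟩ = ĥ₂(Q) ≠ ĥ₂(−Q) = ⟨−Q,−Q⟩ = ⟨Q,Q⟩`. (`p = 2` twin of
`IsCanonical.exists_isMazurTateSigmaPair`.) [cite: MazurSteinTate2006, Thm. 1.3 and §1 eq. (1.1)]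
[cite: SteinWuthrich2013, §4.1 eq. (4.1)] -/
theorem PAdicHeightData.IsCanonical.exists_isMazurTateSigmaPair_two [W.IsElliptic] [W.IsIntegral ℤ]
    {Dh : PAdicHeightData W 2} (hDh : Dh.IsCanonical) {x y : ℚ}
    {hxy : W.toAffine.Nonsingular x y} (hQ : W.IsAdmissible 2 (.some x y hxy))
    (ha : W.a₁ * x + W.a₃ ≠ 0) :
    ∃ σ : ℚ_[2]⟦X⟧, ∃ c : ℚ_[2], (W.baseChange ℚ_[2]).IsMazurTateSigmaPair σ c := by
  by_contra h
  have hx : 1 < ‖(x : ℚ_[2])‖ := hQ.2.1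
  have hz := norm_div_lt_norm_two_of_isAdmissible_two hQ
  have h1 := hDh _ hQ
  have h2 := hDh _ (isAdmissible_neg hQ)
  have h3 : Dh.pairing (-(.some x y hxy : W.toAffine.Point)) (-(.some x y hxy)) =
      Dh.pairing (.some x y hxy) (.some x y hxy) := by
    simp only [map_neg, AddMonoidHom.neg_apply, neg_neg]
  exact W.canonicalPAdicHeight_neg_ne_of_not_exists_of_norm_div_lt h hxy hx hz ha (by rw [← h2, h3, h1])

variable {W} in
/-- **No canonical `2`-adic height datum (point form).** For a `ℤ`-integral elliptic `W/ℚ` with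
`‖a₁‖₂ = 1` and ONE admissible point at `2`, no `Dh : PAdicHeightData W 2` satisfies `Dh.IsCanonical`:
a canonical datum would force a Mazur–Tate pair (`a₁x(Q) + a₃ ≠ 0` is automatic,
`a₁_mul_add_a₃_ne_zero_of_isAdmissible`), and there is none (`2 ∤ a₁`).
[cite: Silverman2005DivPoly, §5 Rem. 2] [cite: MazurSteinTate2006, Thm. 1.3 and §1 eq. (1.1)] -/
theorem PAdicHeightData.not_isCanonical_two_of_isAdmissible [W.IsElliptic] [W.IsIntegral ℤ]
    (ha₁ : ‖((W.a₁ : ℚ) : ℚ_[2])‖ = 1) {x y : ℚ} {hxy : W.toAffine.Nonsingular x y}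
    (hQ : W.IsAdmissible 2 (.some x y hxy)) (Dh : PAdicHeightData W 2) : ¬ Dh.IsCanonical :=
  fun hDh => W.not_exists_isMazurTateSigmaPair_two_of_norm_a₁_eq_one ha₁
    (hDh.exists_isMazurTateSigmaPair_two hQ (a₁_mul_add_a₃_ne_zero_of_isAdmissible hQ ha₁))

variable {W} in
/-- **No canonical `2`-adic height datum (infinite-order form).** For a `ℤ`-integral elliptic `W/ℚ`
with `‖a₁‖₂ = 1` and a point of infinite order, no `Dh : PAdicHeightData W 2` is canonical (an
admissible point exists: `exists_isAdmissible_a₁_mul_add_a₃_ne_zero`, `a₁ ≠ 0`).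
[cite: Silverman2005DivPoly, §5 Rem. 2] [cite: MazurSteinTate2006, §1] -/
theorem PAdicHeightData.not_isCanonical_two_of_not_isOfFinAddOrder [W.IsElliptic] [W.IsIntegral ℤ]
    (ha₁ : ‖((W.a₁ : ℚ) : ℚ_[2])‖ = 1) {P : W.toAffine.Point} (hP : ¬ IsOfFinAddOrder P)
    (Dh : PAdicHeightData W 2) : ¬ Dh.IsCanonical := by
  have ha : W.a₁ ≠ 0 ∨ W.a₃ ≠ 0 := by
    refine Or.inl fun h0 => ?_
    rw [h0, Rat.cast_zero, norm_zero] at ha₁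
    exact zero_ne_one ha₁
  obtain ⟨x, y, hxy, hQ, -⟩ := W.exists_isAdmissible_a₁_mul_add_a₃_ne_zero (p := 2) hP ha
  exact PAdicHeightData.not_isCanonical_two_of_isAdmissible ha₁ hQ Dh

/-- **No canonical `2`-adic height datum (rank form).** For a `ℤ`-integral elliptic `W/ℚ` with
`‖a₁‖₂ = 1` and `rank E(ℚ) ≠ 0`: `¬ ∃ Dh : PAdicHeightData W 2, Dh.IsCanonical`. On these curves every
tree statement `∀ Dh : PAdicHeightData W 2, Dh.IsCanonical → …` is vacuous and the `p = 2` analogue of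
`exists_isCanonical_of_odd` is false. [cite: Silverman2005DivPoly, §5 Rem. 2]
[cite: MazurSteinTate2006, §1 eq. (1.1) and Thm. 1.3] -/
theorem not_exists_isCanonical_two_of_mordellWeilRank_ne_zero [W.IsElliptic] [W.IsIntegral ℤ]
    (ha₁ : ‖((W.a₁ : ℚ) : ℚ_[2])‖ = 1) (hr : W.mordellWeilRank ≠ 0) :
    ¬ ∃ Dh : PAdicHeightData W 2, Dh.IsCanonical := by
  rintro ⟨Dh, hDh⟩
  obtain ⟨P, hP⟩ := W.exists_not_isOfFinAddOrder_of_mordellWeilRank_ne_zero hr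
  exact PAdicHeightData.not_isCanonical_two_of_not_isOfFinAddOrder ha₁ hP Dh hDh

/-- **The tree's chosen canonical `2`-adic height datum of such a curve is the ZERO pairing** (junk
branch of `cyclotomicPAdicHeight`). [cite: MazurSteinTate2006, §1 eq. (1.1)] -/
theorem cyclotomicPAdicHeight_two_eq_zero_of_mordellWeilRank_ne_zero [W.IsElliptic] [W.IsIntegral ℤ]
    (ha₁ : ‖((W.a₁ : ℚ) : ℚ_[2])‖ = 1) (hr : W.mordellWeilRank ≠ 0) :
    W.cyclotomicPAdicHeight 2 = PAdicHeightData.zero W 2 :=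
  cyclotomicPAdicHeight_of_not_exists (W.not_exists_isCanonical_two_of_mordellWeilRank_ne_zero ha₁ hr)

/-- The zero datum has `p`-adic regulator `0` as soon as `rank E(ℚ) ≠ 0` (a Gram determinant of size
`rank ≥ 1` with all entries `0`; size by `IsMordellWeilBasis.card_eq_holds`; junk `0` if no basis).
[cite: MazurTateTeitelbaum1986Invent, §II.4] -/
theorem padicRegulator_zero_eq_zero_of_mordellWeilRank_ne_zero [W.IsElliptic] (p : ℕ) [Fact p.Prime]
    (hr : W.mordellWeilRank ≠ 0) : padicRegulator (PAdicHeightData.zero W p) = 0 := by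
  unfold padicRegulator
  split_ifs with h
  · have hcard := IsMordellWeilBasis.card_eq_holds (W := W) h.choose_spec.choose_spec
    rw [Fintype.card_fin] at hcard
    have hn : h.choose ≠ 0 := by rw [hcard]; exact hr
    haveI : Nonempty (Fin h.choose) := ⟨⟨0, Nat.pos_of_ne_zero hn⟩⟩
    unfold padicRegulatorOf
    have hM : (PAdicHeightData.zero W p).pairingMatrix h.choose_spec.choose = 0 := by
      ext i j
      simp [PAdicHeightData.pairingMatrix]
    rw [hM]
    convert Matrix.det_zero (n := Fin h.choose) (R := ℚ_[p])
  · rfl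

/-- **… hence the tree's `2`-adic regulator of such a curve is `0`** and `SchneiderConjecture
(W.cyclotomicPAdicHeight 2)` fails — as a statement about the tree's junk value, not about the
`2`-adic height of Schneider / Mazur–Tate (which is non-degenerate on CM curves: Bertrand 1984).
[cite: MazurTateTeitelbaum1986Invent, §II.4] [cite: MazurSteinTate2006, §1 eq. (1.1)] -/
theorem padicRegulator_cyclotomicPAdicHeight_two_eq_zero [W.IsElliptic] [W.IsIntegral ℤ]
    (ha₁ : ‖((W.a₁ : ℚ) : ℚ_[2])‖ = 1) (hr : W.mordellWeilRank ≠ 0) :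
    padicRegulator (W.cyclotomicPAdicHeight 2) = 0 := by
  rw [W.cyclotomicPAdicHeight_two_eq_zero_of_mordellWeilRank_ne_zero ha₁ hr]
  exact W.padicRegulator_zero_eq_zero_of_mordellWeilRank_ne_zero 2 hr

/-- Same, as the failure of `SchneiderConjecture` for the tree's junk datum at `2`.
[cite: Schneider1982PadicHeightI, §1] -/
theorem not_schneiderConjecture_cyclotomicPAdicHeight_two [W.IsElliptic] [W.IsIntegral ℤ]
    (ha₁ : ‖((W.a₁ : ℚ) : ℚ_[2])‖ = 1) (hr : W.mordellWeilRank ≠ 0) :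
    ¬ SchneiderConjecture (W.cyclotomicPAdicHeight 2) := by
  unfold SchneiderConjecture
  rw [W.padicRegulator_cyclotomicPAdicHeight_two_eq_zero ha₁ hr]
  exact fun h => h rfl

end NoCanonical

end WeierstrassCurve
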